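import Mathlib
import Summits.Ventures.HodgeRepro.Tier4.Line4.RatioAssembly
import Summits.Ventures.HodgeRepro.Tier4.Line4.UnitBeta
import Summits.Ventures.HodgeRepro.Tier4.Line4.OrbitProper
import Summits.Ventures.HodgeRepro.Tier4.Line4.SuppMeasureFinite

/-!
# Tier4/Line4/RatioFinal — THE (F) DISPLAY OF RECORD with the (β) unit BY NAME: (S-RATIO) modulo the unit's finiteness

Blind re-derivation cell `pub-hodge-repro`, Tier 4 «prove the step» (README §9–§10), seat t4-L1-p4 (gen 5; LINE L4; the
last link after S15836/S15843).  Tree path `lean/Summits/Ventures/HodgeRepro/Tier4/Line4/RatioFinal.lean`.  Imports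
`Line4/RatioAssembly` (this seat: `ratio_display_of_beta_cover`), `Line4/UnitBeta` (t4-L2-p2, p712358: `unit_beta_of_ne_zero`
= the assembly's `hβ` binder verbatim), `Line4/OrbitProper` (t4-L2-p3: `hasProperFinOrbit_of_isLinRegular`) and `Line4/SuppMeasureFinite`
(t4-L2-p1: `suppMeasure_ne_top`).  Mathlib-level; no literature; no `def`.

WHAT.  `ratio_display_of_unit_beta` = `ratio_display_of_beta_cover` with the (β) binder discharged by L2-p2's
`unit_beta_of_ne_zero` (the unit currency `νf((Z_f ∩ levelTf 1) · levelTf N)` is the assembly's `v` verbatim, `N ≠ 0`).  What remains displayed: `hfin` (the unit's finiteness `suppMeasure_ne_top`: ZDOMAIN-EX (iv)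
`hDZc` + PROPER at `γ₀`), `hDZf hfd` (the fundamental domain of the rational centre), `hZ : CentreFinFinite W` (the CM input),
the integrality of `γ₀, γ₀⁻¹` above `q` (LevelPrime's clause), the plane's data (`hΩ … hB`, `hreg`, `hq`), the chain's Haar
normalisations, PSPLIT's `hcq`, and the finiteness of the archimedean tori.  `ratio_display_of_unit_beta_of_proper` discharges
`hfin` too, by `suppMeasure_ne_top` from ZDOMAIN-EX (iv) `hDZc` and PROPER at `γ₀` (`hasProperFinOrbit_of_isLinRegular`,
`hg : IsGenuineRow W`): then NOTHING of (F) is displayed beyond the plane's data, the domain and the CM input.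

Nothing here says anything about the status of the Hodge conjecture for CM abelian varieties, which is NOT proved
(HC_CM is NOT proved by anyone in this repository).
-/

set_option autoImplicit false
noncomputable section
namespace Summit.Ventures.HodgeRepro.Tier4.Line4
open Summit.Ventures.HodgeRepro.Tier4 Summit.Ventures.HodgeRepro.Tier4.Common
  Summit.Ventures.HodgeRepro.Tier4.Line1 MeasureTheory IsDedekindDomain NumberField Matrix
open scoped ENNReal NNReal Pointwise

section Final
variable {k : Type} [Field k] [NumberField k] (W : PlaneData k)

variable [MeasurableSpace (GA W)] [BorelSpace (GA W)] (R : RTFData W)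

/-- **(S-RATIO) WITH THE (β) UNIT BY NAME**: the display over ALL rational `γ` at the levels `q^(n + c₀ + 1)`, from (F-c),
the currency match, (S-IDX) and `unit_beta`, modulo the unit's finiteness `hfin`. -/
theorem ratio_display_of_unit_beta {d : k}
    (hΩ : W.Ω * W.Ω = -(d • (1 : Matrix (Fin 4) (Fin 4) k)))
    (hd : ¬ IsSquare (-d)) (hΩB : W.Ω * W.B = -(W.B * W.Ωᵀ)) (hPB : ∀ i, W.P i * W.B = W.B * (W.P i)ᵀ)
    (hQB : ∀ j, W.Q j * W.B = W.B * (W.Q j)ᵀ) (hPr : ∀ i, (W.P i).rank = 2) (hQr : ∀ j, (W.Q j).rank = 2)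
    (hB : W.B.det ≠ 0) (γ₀ : rationalPoints W) (hreg : IsLinRegular W γ₀) (q : ℕ) (hq : q.Prime)
    (hγ₀ : ∀ v : HeightOneSpectrum (𝓞 k), (q : 𝓞 k) ∈ v.asIdeal → ∀ i j,
      Valued.v (finPart k (GA.mat W (GA.ofFinPart W (γ₀ : GA W)) i j) v) ≤ 1)
    (hγ₀' : ∀ v : HeightOneSpectrum (𝓞 k), (q : 𝓞 k) ∈ v.asIdeal → ∀ i j,
      Valued.v (finPart k (GA.mat W (GA.ofFinPart W (γ₀ : GA W))⁻¹ i j) v) ≤ 1)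
    (hR : R.IsHaar) (compT : IsCompact (closure R.DT)) (compT' : IsCompact (closure R.DT'))
    (νinf : Measure (torusInf W)) [νinf.IsHaarMeasure] [IsFiniteMeasure νinf]
    (νf : Measure (torusFin W)) [νf.IsHaarMeasure]
    (c : ℝ≥0) (hc : R.μT = c • Measure.map (torusSplit W).symm (νinf.prod νf))
    (νinf' : Measure (torusInf' W)) [νinf'.IsHaarMeasure] [IsFiniteMeasure νinf']
    (νf' : Measure (torusFin' W)) [νf'.IsHaarMeasure]
    (c' : ℝ≥0) (hc' : R.μT' = c' • Measure.map (torusSplit' W).symm (νinf'.prod νf'))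
    (νS : Measure (torusFinAt W (placesAbove (k := k) q))) [νS.IsHaarMeasure]
    (νA : Measure (torusFinAway W (placesAbove (k := k) q))) [νA.IsHaarMeasure]
    (cq : ℝ≥0) (hcq : νf = cq • Measure.map (torusFinSplit W (placesAbove (k := k) q)).symm (νS.prod νA))
    (DZf : Set (torusFin W)) (hDZf : MeasurableSet DZf) (hfd : IsFundamentalDomain (centreFin W) DZf νf)
    (hZ : CentreFinFinite W)
    (hfin : ∀ N : ℕ, N ≠ 0 → suppMeasure W νf νf' (γ₀ : GA W) DZf N (γ₀ : GA W) ≠ ⊤) :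
    ∃ c₀ : ℕ, ∃ C' : ℝ, ∀ (n : ℕ) (γ : rationalPoints W),
      (suppMeasureFolded W R (γ₀ : GA W) (q ^ (n + c₀ + 1)) (γ : GA W)).toReal ≤
        C' * (suppMeasure W νf νf' (γ₀ : GA W) DZf (q ^ (n + c₀ + 1)) (γ₀ : GA W)).toReal := by
  refine ratio_display_of_beta_cover W R hΩ hd hΩB hPB hQB hPr hQr hB γ₀ hreg q hq hγ₀ hγ₀' hR compT compT' νinf νf
    c hc νinf' νf' c' hc' νS νA cq hcq DZf
    (Nat.card (centreFin W ⊓ levelTfSub W 1 : Subgroup (torusFin W)) : ℝ≥0∞) (ENNReal.natCast_ne_top _) ?_ hfin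
  intro N hN
  exact unit_beta_of_ne_zero W νf νf' (γ₀ : GA W) DZf hDZf hfd hZ N hN

/-- **(S-RATIO) WITH THE UNIT'S FINITENESS BY NAME TOO**: `hfin` from `suppMeasure_ne_top` (ZDOMAIN-EX (iv) `hDZc` + PROPER at
`γ₀`, L2-p3's `hasProperFinOrbit_of_isLinRegular` under `hg : IsGenuineRow W`) — the display (F) of record from the plane's
data, the domain `DZ_f` and the CM input alone. -/
theorem ratio_display_of_unit_beta_of_proper {d : k}
    (hΩ : W.Ω * W.Ω = -(d • (1 : Matrix (Fin 4) (Fin 4) k)))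
    (hd : ¬ IsSquare (-d)) (hΩB : W.Ω * W.B = -(W.B * W.Ωᵀ)) (hPB : ∀ i, W.P i * W.B = W.B * (W.P i)ᵀ)
    (hQB : ∀ j, W.Q j * W.B = W.B * (W.Q j)ᵀ) (hPr : ∀ i, (W.P i).rank = 2) (hQr : ∀ j, (W.Q j).rank = 2)
    (hB : W.B.det ≠ 0) (hg : IsGenuineRow W) (γ₀ : rationalPoints W) (hreg : IsLinRegular W γ₀) (q : ℕ) (hq : q.Prime)
    (hγ₀ : ∀ v : HeightOneSpectrum (𝓞 k), (q : 𝓞 k) ∈ v.asIdeal → ∀ i j,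
      Valued.v (finPart k (GA.mat W (GA.ofFinPart W (γ₀ : GA W)) i j) v) ≤ 1)
    (hγ₀' : ∀ v : HeightOneSpectrum (𝓞 k), (q : 𝓞 k) ∈ v.asIdeal → ∀ i j,
      Valued.v (finPart k (GA.mat W (GA.ofFinPart W (γ₀ : GA W))⁻¹ i j) v) ≤ 1)
    (hR : R.IsHaar) (compT : IsCompact (closure R.DT)) (compT' : IsCompact (closure R.DT'))
    (νinf : Measure (torusInf W)) [νinf.IsHaarMeasure] [IsFiniteMeasure νinf]
    (νf : Measure (torusFin W)) [νf.IsHaarMeasure]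
    (c : ℝ≥0) (hc : R.μT = c • Measure.map (torusSplit W).symm (νinf.prod νf))
    (νinf' : Measure (torusInf' W)) [νinf'.IsHaarMeasure] [IsFiniteMeasure νinf']
    (νf' : Measure (torusFin' W)) [νf'.IsHaarMeasure]
    (c' : ℝ≥0) (hc' : R.μT' = c' • Measure.map (torusSplit' W).symm (νinf'.prod νf'))
    (νS : Measure (torusFinAt W (placesAbove (k := k) q))) [νS.IsHaarMeasure]
    (νA : Measure (torusFinAway W (placesAbove (k := k) q))) [νA.IsHaarMeasure]
    (cq : ℝ≥0) (hcq : νf = cq • Measure.map (torusFinSplit W (placesAbove (k := k) q)).symm (νS.prod νA))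
    (DZf : Set (torusFin W)) (hDZf : MeasurableSet DZf) (hfd : IsFundamentalDomain (centreFin W) DZf νf)
    (hDZc : ∀ C : Set (torusFin W), IsCompact C → IsCompact (closure (DZf ∩ (C * (ZfIn W : Set (torusFin W))))))
    (hZ : CentreFinFinite W) :
    ∃ c₀ : ℕ, ∃ C' : ℝ, ∀ (n : ℕ) (γ : rationalPoints W),
      (suppMeasureFolded W R (γ₀ : GA W) (q ^ (n + c₀ + 1)) (γ : GA W)).toReal ≤
        C' * (suppMeasure W νf νf' (γ₀ : GA W) DZf (q ^ (n + c₀ + 1)) (γ₀ : GA W)).toReal :=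
  ratio_display_of_unit_beta W R hΩ hd hΩB hPB hQB hPr hQr hB γ₀ hreg q hq hγ₀ hγ₀' hR compT compT' νinf νf c hc
    νinf' νf' c' hc' νS νA cq hcq DZf hDZf hfd hZ fun _ hN =>
      suppMeasure_ne_top W νf νf' (γ₀ : GA W) DZf hDZc hN (hasProperFinOrbit_of_isLinRegular W hB hg γ₀ hreg)

end Final

end Summit.Ventures.HodgeRepro.Tier4.Line4

end
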